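import Mathlib
import HarnessLib

/-!
# The Eneström–Kakeya theorem

Topic: Analysis / Complex (`Literature/Analysis/Complex/`).

**Eneström–Kakeya.** If `p(z) = a₀ + a₁ z + ⋯ + aₙ zⁿ` has real coefficients with
`0 ≤ a₀ ≤ a₁ ≤ ⋯ ≤ aₙ`, `p ≠ 0`, then every (complex) zero of `p` satisfies `|z| ≤ 1`
([Henrici1974, §6.4 Problem 4]; [Prasolov2004, §1.1.2 Thm 1.1.5(a)]). More generally, for
positive coefficients every zero lies in the annulus

  `min_k a_k/a_{k+1} ≤ |z| ≤ max_k a_k/a_{k+1}`  (`0 ≤ k < n`)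

[Prasolov2004, Thm 1.1.5(a)]. Proof (loc. cit.): the polynomial `(t − z) p(z)`,
`t = max a_k/a_{k+1}`, has the coefficients `t a₀, t a₁ − a₀, …, t aₙ − a_{n−1} ≥ 0` and `−aₙ`,
so at a zero `z` of `p` with `|z| ≥ t`,
`aₙ |z|^{n+1} ≤ Σ_{k≤n} (t a_k − a_{k−1}) |z|^k ≤ (|z|/t)ⁿ Σ_{k≤n} (t a_k − a_{k−1}) t^k = aₙ t |z|ⁿ`.

Main statements (`p : ℝ[X]`, zeros `z : ℂ` with `aeval z p = 0`):

* `norm_root_le_of_coeff_le` — `p ≠ 0`, `t > 0`, `a₀ ≥ 0`, `a_k ≤ t a_{k+1}` (`k < n`) ⟹ `‖z‖ ≤ t`;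
* `le_norm_root_of_coeff_ge` — `s > 0`, `aₙ > 0`, `s a_{k+1} ≤ a_k` (`k < n`) ⟹ `s ≤ ‖z‖`;
* `enestrom_kakeya` — the classical statement (`t = 1`);
* `enestrom_kakeya_annulus` — positive coefficients, `n ≥ 1` ⟹
  `inf_k a_k/a_{k+1} ≤ ‖z‖ ≤ sup_k a_k/a_{k+1}` (`Finset.inf'`/`Finset.sup'` over `range n`).

Not formalised: Ostrowski's strict refinement (Thm 1.1.5(b)), the Anderson–Saff–Varga sharpness
discussion, Cauchy's Theorem 1.1.3 on the unique positive root (the proof here is direct).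
-/

noncomputable section

open Polynomial Finset

namespace Literature.Analysis.Complex.EnestromKakeya

/-! ## Coefficients of `(C t − X) · p` and `(X − C s) · p` -/

/-- Coefficient `k+1` of `(C a - X) * q`. [folklore] -/
private theorem coeff_C_sub_X_mul_succ (p : ℝ[X]) (t : ℝ) (k : ℕ) :
    ((C t - X) * p).coeff (k + 1) = t * p.coeff (k + 1) - p.coeff k := by
  rw [sub_mul, coeff_sub, coeff_C_mul, coeff_X_mul]

/-- Constant coefficient of `(C a - X) * q`. [folklore] -/
private theorem coeff_C_sub_X_mul_zero (p : ℝ[X]) (t : ℝ) :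
    ((C t - X) * p).coeff 0 = t * p.coeff 0 := by
  rw [sub_mul, coeff_sub, coeff_C_mul, coeff_X_mul_zero, sub_zero]

/-- Coefficient `k+1` of `(X - C a) * q`. [folklore] -/
private theorem coeff_X_sub_C_mul_succ (p : ℝ[X]) (s : ℝ) (k : ℕ) :
    ((X - C s) * p).coeff (k + 1) = p.coeff k - s * p.coeff (k + 1) := by
  rw [sub_mul, coeff_sub, coeff_C_mul, coeff_X_mul]

/-- Constant coefficient of `(X - C a) * q`. [folklore] -/
private theorem coeff_X_sub_C_mul_zero (p : ℝ[X]) (s : ℝ) :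
    ((X - C s) * p).coeff 0 = -(s * p.coeff 0) := by
  rw [sub_mul, coeff_sub, coeff_C_mul, coeff_X_mul_zero, zero_sub]

/-- Degree bookkeeping for a linear factor times `q`. [folklore] -/
private theorem natDegree_linear_mul_lt (p : ℝ[X]) (a b : ℝ[X]) (ha : a.natDegree ≤ 1)
    (hab : b = a * p) : b.natDegree < p.natDegree + 2 := by
  rw [hab]
  calc (a * p).natDegree ≤ a.natDegree + p.natDegree := natDegree_mul_le
    _ < p.natDegree + 2 := by omega

/-- `natDegree (C a - X) ≤ 1`. [folklore] -/
private theorem natDegree_C_sub_X_le (t : ℝ) : (C t - X : ℝ[X]).natDegree ≤ 1 :=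
  (natDegree_sub_le _ _).trans (by simp)

/-- `natDegree (X - C a) ≤ 1`. [folklore] -/
private theorem natDegree_X_sub_C_le' (s : ℝ) : (X - C s : ℝ[X]).natDegree ≤ 1 :=
  (natDegree_sub_le _ _).trans (by simp)

/-! ## The upper bound -/

/-- Nonnegativity of all coefficients from `a₀ ≥ 0` and `a_k ≤ t a_{k+1}`. [folklore] -/
private theorem coeff_nonneg_of_coeff_le (p : ℝ[X]) {t : ℝ} (ht : 0 < t) (h0 : 0 ≤ p.coeff 0)
    (hmono : ∀ k < p.natDegree, p.coeff k ≤ t * p.coeff (k + 1)) (k : ℕ) : 0 ≤ p.coeff k := by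
  induction k with
  | zero => exact h0
  | succ k ih =>
    by_cases hk : k < p.natDegree
    · have := (ih).trans (hmono k hk)
      exact (mul_nonneg_iff_of_pos_left ht).mp this
    · push Not at hk
      rw [coeff_eq_zero_of_natDegree_lt (by omega)]

/-- **Upper Eneström–Kakeya bound.** If `p ≠ 0` has real coefficients with `a₀ ≥ 0` and
`a_k ≤ t · a_{k+1}` for `k < n` (`t > 0`), then every complex zero satisfies `‖z‖ ≤ t`.
[cite: Prasolov2004, §1.1.2 Thm 1.1.5(a); Henrici1974, §6.4 Problem 4] -/
theorem norm_root_le_of_coeff_le (p : ℝ[X]) (hp : p ≠ 0) {t : ℝ} (ht : 0 < t)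
    (h0 : 0 ≤ p.coeff 0) (hmono : ∀ k < p.natDegree, p.coeff k ≤ t * p.coeff (k + 1))
    {z : ℂ} (hz : aeval z p = 0) : ‖z‖ ≤ t := by
  by_cases hzt : ‖z‖ ≤ t
  · exact hzt
  push Not at hzt
  have hnn := coeff_nonneg_of_coeff_le p ht h0 hmono
  have hlead : 0 < p.coeff p.natDegree :=
    lt_of_le_of_ne (hnn _) (Ne.symm (mt leadingCoeff_eq_zero.mp hp))
  -- the auxiliary polynomial `q = (t − X) p`
  have hqdeg : ((C t - X) * p).natDegree < p.natDegree + 2 :=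
    natDegree_linear_mul_lt p _ _ (natDegree_C_sub_X_le t) rfl
  have hq_nonneg : ∀ i < p.natDegree + 1, 0 ≤ ((C t - X) * p).coeff i := by
    intro i hi
    rcases i with _ | k
    · rw [coeff_C_sub_X_mul_zero]; exact mul_nonneg ht.le h0
    · rw [coeff_C_sub_X_mul_succ, sub_nonneg]; exact hmono k (by omega)
  have hq_top : ((C t - X) * p).coeff (p.natDegree + 1) = -p.coeff p.natDegree := by
    rw [coeff_C_sub_X_mul_succ, coeff_eq_zero_of_natDegree_lt (by omega), mul_zero, zero_sub]
  -- `q(z) = 0`: the top term equals minus the rest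
  have hqz : (∑ i ∈ range (p.natDegree + 1), (((C t - X) * p).coeff i : ℂ) * z ^ i) =
      (p.coeff p.natDegree : ℂ) * z ^ (p.natDegree + 1) := by
    have h1 : aeval z ((C t - X) * p) = 0 := by rw [map_mul, hz, mul_zero]
    rw [aeval_def, eval₂_eq_sum_range' _ hqdeg, sum_range_succ, hq_top] at h1
    push_cast at h1
    linear_combination h1
  -- `q(t) = 0`: the weighted coefficient sum telescopes to `aₙ t^{n+1}`
  have hqt : (∑ i ∈ range (p.natDegree + 1), ((C t - X) * p).coeff i * t ^ i) =
      p.coeff p.natDegree * t ^ (p.natDegree + 1) := by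
    have h1 : ((C t - X) * p).eval t = 0 := by simp
    rw [eval_eq_sum_range' hqdeg, sum_range_succ, hq_top] at h1
    linear_combination h1
  -- norm estimate
  have hn1 : p.coeff p.natDegree * ‖z‖ ^ (p.natDegree + 1) ≤
      ∑ i ∈ range (p.natDegree + 1), ((C t - X) * p).coeff i * ‖z‖ ^ i := by
    have := norm_sum_le (range (p.natDegree + 1))
      (fun i => (((C t - X) * p).coeff i : ℂ) * z ^ i)
    rw [hqz, norm_mul, norm_pow, Complex.norm_real, Real.norm_eq_abs, abs_of_pos hlead] at this
    refine this.trans (le_of_eq (sum_congr rfl fun i hi => ?_))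
    rw [norm_mul, norm_pow, Complex.norm_real, Real.norm_eq_abs,
      abs_of_nonneg (hq_nonneg i (mem_range.mp hi))]
  have hn2 : (∑ i ∈ range (p.natDegree + 1), ((C t - X) * p).coeff i * ‖z‖ ^ i) * t ^ p.natDegree
      ≤ (∑ i ∈ range (p.natDegree + 1), ((C t - X) * p).coeff i * t ^ i) * ‖z‖ ^ p.natDegree := by
    rw [sum_mul, sum_mul]
    refine sum_le_sum fun i hi => ?_
    have hi' : i ≤ p.natDegree := by have := mem_range.mp hi; omega
    have hzi : ‖z‖ ^ i * t ^ p.natDegree ≤ t ^ i * ‖z‖ ^ p.natDegree := by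
      obtain ⟨m, hm⟩ := Nat.exists_eq_add_of_le hi'
      rw [hm, pow_add, pow_add]
      have := pow_le_pow_left₀ ht.le hzt.le m
      have h1 : 0 ≤ ‖z‖ ^ i * t ^ i := by positivity
      nlinarith
    have := hq_nonneg i (mem_range.mp hi)
    calc ((C t - X) * p).coeff i * ‖z‖ ^ i * t ^ p.natDegree
        = ((C t - X) * p).coeff i * (‖z‖ ^ i * t ^ p.natDegree) := by ring
      _ ≤ ((C t - X) * p).coeff i * (t ^ i * ‖z‖ ^ p.natDegree) :=
          mul_le_mul_of_nonneg_left hzi this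
      _ = ((C t - X) * p).coeff i * t ^ i * ‖z‖ ^ p.natDegree := by ring
  rw [hqt] at hn2
  -- combine: `aₙ ‖z‖^{n+1} tⁿ ≤ aₙ t^{n+1} ‖z‖ⁿ`
  have hz0 : 0 < ‖z‖ := ht.trans hzt
  have key : p.coeff p.natDegree * ‖z‖ ^ (p.natDegree + 1) * t ^ p.natDegree ≤
      p.coeff p.natDegree * t ^ (p.natDegree + 1) * ‖z‖ ^ p.natDegree :=
    (mul_le_mul_of_nonneg_right hn1 (pow_nonneg ht.le _)).trans hn2
  have hpos : 0 < p.coeff p.natDegree * t ^ p.natDegree * ‖z‖ ^ p.natDegree := by positivity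
  rw [pow_succ, pow_succ] at key
  nlinarith

/-! ## The lower bound -/

/-- Positivity of the coefficients `a₀, …, aₙ` from `aₙ > 0` and `s a_{k+1} ≤ a_k`. [folklore] -/
private theorem coeff_pos_of_coeff_ge (p : ℝ[X]) {s : ℝ} (hs : 0 < s) (hlead : 0 < p.leadingCoeff)
    (hmono : ∀ k < p.natDegree, s * p.coeff (k + 1) ≤ p.coeff k) :
    ∀ k ≤ p.natDegree, 0 < p.coeff k := by
  suffices h : ∀ j ≤ p.natDegree, 0 < p.coeff (p.natDegree - j) by
    intro k hk
    have := h (p.natDegree - k) (Nat.sub_le _ _)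
    rwa [Nat.sub_sub_self hk] at this
  intro j hj
  induction j with
  | zero => simpa using hlead
  | succ j ih =>
    have hlt : p.natDegree - (j + 1) < p.natDegree := by omega
    have h1 := hmono _ hlt
    have h2 : p.natDegree - (j + 1) + 1 = p.natDegree - j := by omega
    rw [h2] at h1
    exact lt_of_lt_of_le (mul_pos hs (ih (by omega))) h1

/-- **Lower Eneström–Kakeya bound.** If `p` has real coefficients with `aₙ > 0` and
`s · a_{k+1} ≤ a_k` for `k < n` (`s > 0`), then every complex zero satisfies `s ≤ ‖z‖`.
[cite: Prasolov2004, §1.1.2 Thm 1.1.5(a)] -/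
theorem le_norm_root_of_coeff_ge (p : ℝ[X]) {s : ℝ} (hs : 0 < s) (hlead : 0 < p.leadingCoeff)
    (hmono : ∀ k < p.natDegree, s * p.coeff (k + 1) ≤ p.coeff k)
    {z : ℂ} (hz : aeval z p = 0) : s ≤ ‖z‖ := by
  by_cases hzs : s ≤ ‖z‖
  · exact hzs
  push Not at hzs
  have hpos := coeff_pos_of_coeff_ge p hs hlead hmono
  have h0 : 0 < p.coeff 0 := hpos 0 (Nat.zero_le _)
  -- the auxiliary polynomial `q = (X − s) p`
  have hqdeg : ((X - C s) * p).natDegree < p.natDegree + 2 :=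
    natDegree_linear_mul_lt p _ _ (natDegree_X_sub_C_le' s) rfl
  have hq_nonneg : ∀ i < p.natDegree + 1, 0 ≤ ((X - C s) * p).coeff (i + 1) := by
    intro i hi
    rw [coeff_X_sub_C_mul_succ, sub_nonneg]
    by_cases hi' : i < p.natDegree
    · exact hmono i hi'
    · have : i = p.natDegree := by omega
      subst this
      rw [coeff_eq_zero_of_natDegree_lt (by omega), mul_zero]
      exact (hpos _ le_rfl).le
  have hq_bot : ((X - C s) * p).coeff 0 = -(s * p.coeff 0) := coeff_X_sub_C_mul_zero p s
  -- `q(z) = 0`: the constant term equals minus the rest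
  have hqz : (∑ i ∈ range (p.natDegree + 1), (((X - C s) * p).coeff (i + 1) : ℂ) * z ^ (i + 1)) =
      ((s * p.coeff 0 : ℝ) : ℂ) := by
    have h1 : aeval z ((X - C s) * p) = 0 := by rw [map_mul, hz, mul_zero]
    rw [aeval_def, eval₂_eq_sum_range' _ hqdeg, sum_range_succ', hq_bot] at h1
    push_cast at h1 ⊢
    linear_combination h1
  -- `q(s) = 0`
  have hqs : (∑ i ∈ range (p.natDegree + 1), ((X - C s) * p).coeff (i + 1) * s ^ (i + 1)) =
      s * p.coeff 0 := by
    have h1 : ((X - C s) * p).eval s = 0 := by simp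
    rw [eval_eq_sum_range' hqdeg, sum_range_succ', hq_bot] at h1
    linear_combination h1
  -- norm estimate
  have hn1 : s * p.coeff 0 ≤
      ∑ i ∈ range (p.natDegree + 1), ((X - C s) * p).coeff (i + 1) * ‖z‖ ^ (i + 1) := by
    have := norm_sum_le (range (p.natDegree + 1))
      (fun i => (((X - C s) * p).coeff (i + 1) : ℂ) * z ^ (i + 1))
    rw [hqz, Complex.norm_real, Real.norm_eq_abs, abs_of_pos (mul_pos hs h0)] at this
    refine this.trans (le_of_eq (sum_congr rfl fun i hi => ?_))
    rw [norm_mul, norm_pow, Complex.norm_real, Real.norm_eq_abs,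
      abs_of_nonneg (hq_nonneg i (mem_range.mp hi))]
  have hn2 : (∑ i ∈ range (p.natDegree + 1), ((X - C s) * p).coeff (i + 1) * ‖z‖ ^ (i + 1)) * s
      ≤ (∑ i ∈ range (p.natDegree + 1), ((X - C s) * p).coeff (i + 1) * s ^ (i + 1)) * ‖z‖ := by
    rw [sum_mul, sum_mul]
    refine sum_le_sum fun i hi => ?_
    have hzi : ‖z‖ ^ (i + 1) * s ≤ s ^ (i + 1) * ‖z‖ := by
      rw [pow_succ, pow_succ]
      have := pow_le_pow_left₀ (norm_nonneg z) hzs.le i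
      have h1 : 0 ≤ ‖z‖ * s := by positivity
      nlinarith
    have := hq_nonneg i (mem_range.mp hi)
    calc ((X - C s) * p).coeff (i + 1) * ‖z‖ ^ (i + 1) * s
        = ((X - C s) * p).coeff (i + 1) * (‖z‖ ^ (i + 1) * s) := by ring
      _ ≤ ((X - C s) * p).coeff (i + 1) * (s ^ (i + 1) * ‖z‖) :=
          mul_le_mul_of_nonneg_left hzi this
      _ = ((X - C s) * p).coeff (i + 1) * s ^ (i + 1) * ‖z‖ := by ring
  rw [hqs] at hn2
  have key : s * p.coeff 0 * s ≤ s * p.coeff 0 * ‖z‖ :=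
    (mul_le_mul_of_nonneg_right hn1 hs.le).trans hn2
  have hsp : 0 < s * p.coeff 0 := mul_pos hs h0
  nlinarith

/-! ## The classical statements -/

/-- **Eneström–Kakeya theorem.** If `p ≠ 0` has real coefficients
`0 ≤ a₀ ≤ a₁ ≤ ⋯ ≤ aₙ`, then every complex zero of `p` satisfies `‖z‖ ≤ 1`.
[cite: Henrici1974, §6.4 Problem 4; Prasolov2004, §1.1.2 Thm 1.1.5(a)] -/
theorem enestrom_kakeya (p : ℝ[X]) (hp : p ≠ 0) (h0 : 0 ≤ p.coeff 0)
    (hmono : ∀ k < p.natDegree, p.coeff k ≤ p.coeff (k + 1)) {z : ℂ} (hz : aeval z p = 0) :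
    ‖z‖ ≤ 1 :=
  norm_root_le_of_coeff_le p hp one_pos h0 (fun k hk => by rw [one_mul]; exact hmono k hk) hz

/-- **Eneström–Kakeya annulus.** If `p` has positive real coefficients `a₀, …, aₙ` (`n ≥ 1`),
then every complex zero satisfies `min_{k<n} a_k/a_{k+1} ≤ ‖z‖ ≤ max_{k<n} a_k/a_{k+1}`.
[cite: Prasolov2004, §1.1.2 Thm 1.1.5(a)] -/
theorem enestrom_kakeya_annulus (p : ℝ[X]) (hn : 0 < p.natDegree)
    (hpos : ∀ k ≤ p.natDegree, 0 < p.coeff k) {z : ℂ} (hz : aeval z p = 0) :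
    (range p.natDegree).inf' (nonempty_range_iff.mpr hn.ne') (fun k => p.coeff k / p.coeff (k + 1))
      ≤ ‖z‖ ∧
    ‖z‖ ≤ (range p.natDegree).sup' (nonempty_range_iff.mpr hn.ne')
      (fun k => p.coeff k / p.coeff (k + 1)) := by
  have hne : (range p.natDegree).Nonempty := nonempty_range_iff.mpr hn.ne'
  have hratio : ∀ k < p.natDegree, 0 < p.coeff k / p.coeff (k + 1) := fun k hk =>
    div_pos (hpos k hk.le) (hpos (k + 1) hk)
  constructor
  · refine le_norm_root_of_coeff_ge p ?_ (hpos _ le_rfl) (fun k hk => ?_) hz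
    · obtain ⟨k, hk, hkeq⟩ := exists_mem_eq_inf' hne (fun k => p.coeff k / p.coeff (k + 1))
      rw [hkeq]; exact hratio k (mem_range.mp hk)
    · have h1 := inf'_le (fun k => p.coeff k / p.coeff (k + 1)) (mem_range.mpr hk)
      have h2 := hpos (k + 1) hk
      calc (range p.natDegree).inf' hne (fun k => p.coeff k / p.coeff (k + 1)) * p.coeff (k + 1)
          ≤ p.coeff k / p.coeff (k + 1) * p.coeff (k + 1) := mul_le_mul_of_nonneg_right h1 h2.le
        _ = p.coeff k := div_mul_cancel₀ _ h2.ne'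
  · have hp : p ≠ 0 := by rintro rfl; simp at hn
    refine norm_root_le_of_coeff_le p hp ?_ (hpos 0 (Nat.zero_le _)).le (fun k hk => ?_) hz
    · obtain ⟨k, hk, hkeq⟩ := exists_mem_eq_sup' hne (fun k => p.coeff k / p.coeff (k + 1))
      rw [hkeq]; exact hratio k (mem_range.mp hk)
    · have h1 := le_sup' (fun k => p.coeff k / p.coeff (k + 1)) (mem_range.mpr hk)
      have h2 := hpos (k + 1) hk
      calc p.coeff k = p.coeff k / p.coeff (k + 1) * p.coeff (k + 1) := (div_mul_cancel₀ _ h2.ne').symm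
        _ ≤ (range p.natDegree).sup' hne (fun k => p.coeff k / p.coeff (k + 1)) * p.coeff (k + 1) :=
            mul_le_mul_of_nonneg_right h1 h2.le

end Literature.Analysis.Complex.EnestromKakeya

end
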